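import Summits.Ventures.CertifiedManyBodySolver.Downfold.PressureContinuumRecord
import HarnessLib

/-!
# The P-continuum record, II: REFINEMENT — a new computed column inside a gap moves no `by_P` item
# outside that gap

Venture CertifiedManyBodySolver, cell `pub/hubbard-downfold`, seat hubbard-downfold-mod-2; namespace
`Summit.Ventures.CertifiedManyBodySolver.Downfold.PCont.Rec` (continues `PressureContinuumRecord`).
`insertCol R a c wc gl gr` refines the record by ONE computed column at `c` inside the gap whose
left end is `a` (word `wc`; the gap splits into two gaps with interval words `gl`, `gr`; reaches
unchanged) — the operation a GRID CURE performs (`router/P-INTERVALS.md` «GRID CURES (P.12(d))»,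
lead RULING R-dq: e.g. V @10/@20 inside (0, 30)). PROVED: `lookup_insertCol_of_not_mem_gap` —
**for two consecutive computed pressures `a < c < b`, every pressure `P ≤ a` or `P ≥ b` keeps its
item** (kind and word): a densification re-reads only the gap it lands in; the lemmas before it
locate the bracketing columns of the refined record (`insertCol_gapLeft_of_le/_of_gt`,
`insertCol_gapRight_of_le/_of_lt`). WHAT THIS IS NOT: a statement about which word the new
column or the two new gaps carry — those are read off the new record by §P.12 as always.
-/

namespace Summit.Ventures.CertifiedManyBodySolver.Downfold

namespace PCont

namespace Rec

variable {π ω : Type*} [LinearOrder π] {R : Rec π ω}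

/-! ### Refinement: a new computed column INSIDE a gap moves no item outside that gap -/

/-- The bracketing column below, when present, is a computed pressure below `P`. [folklore] -/
theorem mem_of_gapLeft_eq_some {P x : π} (h : R.gapLeft P = some x) : x ∈ R.pts ∧ x < P := by
  unfold gapLeft at h
  split_ifs at h with hne
  · cases h
    exact Finset.mem_filter.1 (Finset.max'_mem _ hne)

/-- The bracketing column below dominates every computed pressure below `P`. [folklore] -/
theorem le_of_gapLeft_eq_some {P x y : π} (h : R.gapLeft P = some x) (hy : y ∈ R.pts)
    (hyP : y < P) : y ≤ x := by
  unfold gapLeft at h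
  split_ifs at h with hne
  · cases h
    exact Finset.le_max' _ _ (Finset.mem_filter.2 ⟨hy, hyP⟩)

variable (R) in
/-- **REFINE the record by one computed column** at `c` (word `wc`) inside the gap whose left end is
`a`: the gap splits into `(a, c)` with interval word `gl` and `(c, ·)` with interval word `gr`;
reaches unchanged. [folklore] -/
def insertCol (a c : π) (wc : ω) (gl gr : Option ω) : Rec π ω where
  pts := insert c R.pts
  cw := Function.update R.cw c wc
  gw := Function.update (Function.update R.gw a gl) c gr
  rw := R.rw

section Refine

variable {a b c : π} {wc : ω} {gl gr : Option ω}

/-- The refined record's reaches are the old ones. [folklore] -/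
@[simp] theorem insertCol_rw : (R.insertCol a c wc gl gr).rw = R.rw := rfl

/-- Below a pressure at most `c` the computed columns are unchanged. [folklore] -/
theorem insertCol_below_of_le {P : π} (h : P ≤ c) : (R.insertCol a c wc gl gr).below P = R.below P := by
  simp only [below, insertCol, Finset.filter_insert, not_lt.2 h, if_false]

/-- Above a pressure at least `c` the computed columns are unchanged. [folklore] -/
theorem insertCol_above_of_le {P : π} (h : c ≤ P) : (R.insertCol a c wc gl gr).above P = R.above P := by
  simp only [above, insertCol, Finset.filter_insert, not_lt.2 h, if_false]

/-- Below a pressure beyond `c` the new column joins the columns below. [folklore] -/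
theorem insertCol_below_of_lt {P : π} (h : c < P) :
    (R.insertCol a c wc gl gr).below P = insert c (R.below P) := by
  simp only [below, insertCol, Finset.filter_insert, h, if_true]

/-- Above a pressure before `c` the new column joins the columns above. [folklore] -/
theorem insertCol_above_of_lt {P : π} (h : P < c) :
    (R.insertCol a c wc gl gr).above P = insert c (R.above P) := by
  simp only [above, insertCol, Finset.filter_insert, h, if_true]

/-- The bracketing column below is unchanged at pressures at most `c`. [folklore] -/
theorem insertCol_gapLeft_of_le {P : π} (h : P ≤ c) :
    (R.insertCol a c wc gl gr).gapLeft P = R.gapLeft P := by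
  unfold gapLeft
  rw [insertCol_below_of_le h]

/-- The bracketing column above is unchanged at pressures at least `c`. [folklore] -/
theorem insertCol_gapRight_of_le {P : π} (h : c ≤ P) :
    (R.insertCol a c wc gl gr).gapRight P = R.gapRight P := by
  unfold gapRight
  rw [insertCol_above_of_le h]

/-- Below the split gap the new column is NOT the nearest column above (the gap's left end `a` is
nearer). [folklore] -/
theorem insertCol_gapRight_of_lt (ha : a ∈ R.pts) (hac : a < c) {P : π} (hP : P < a) :
    (R.insertCol a c wc gl gr).gapRight P = R.gapRight P := by
  have haA : a ∈ R.above P := Finset.mem_filter.2 ⟨ha, hP⟩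
  have hne : (R.above P).Nonempty := ⟨a, haA⟩
  unfold gapRight
  rw [insertCol_above_of_lt (hP.trans hac), dif_pos (Finset.insert_nonempty _ _), dif_pos hne,
    Finset.min'_insert, min_eq_right]
  exact (Finset.min'_le _ _ haA).trans hac.le

/-- Above the split gap the new column is NOT the nearest column below (the gap's right end `b` is
nearer). [folklore] -/
theorem insertCol_gapLeft_of_gt (hb : b ∈ R.pts) (hcb : c < b) {P : π} (hP : b < P) :
    (R.insertCol a c wc gl gr).gapLeft P = R.gapLeft P := by
  have hbB : b ∈ R.below P := Finset.mem_filter.2 ⟨hb, hP⟩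
  have hne : (R.below P).Nonempty := ⟨b, hbB⟩
  unfold gapLeft
  rw [insertCol_below_of_lt (hcb.trans hP), dif_pos (Finset.insert_nonempty _ _), dif_pos hne,
    Finset.max'_insert, max_eq_right]
  exact hcb.le.trans (Finset.le_max' _ _ hbB)

/-- The gap item is unchanged BELOW the split gap. [folklore] -/
theorem insertCol_gapItem_of_lt (hc : R.Consecutive a b) (hac : a < c) {P : π} (hP : P < a) :
    (R.insertCol a c wc gl gr).gapItem P = R.gapItem P := by
  unfold gapItem
  rw [insertCol_gapLeft_of_le (hP.trans hac).le, insertCol_gapRight_of_lt hc.1 hac hP]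
  rcases hx : R.gapLeft P with _ | x
  · rfl
  · obtain ⟨-, hxP⟩ := mem_of_gapLeft_eq_some hx
    have hxa : x ≠ a := (hxP.trans hP).ne
    have hxc : x ≠ c := (hxP.trans (hP.trans hac)).ne
    rcases R.gapRight P with _ | y
    · rfl
    · simp [insertCol, Function.update_of_ne hxc, Function.update_of_ne hxa]

/-- The gap item is unchanged ABOVE the split gap. [folklore] -/
theorem insertCol_gapItem_of_gt (hc : R.Consecutive a b) (hcb : c < b) {P : π} (hP : b < P) :
    (R.insertCol a c wc gl gr).gapItem P = R.gapItem P := by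
  unfold gapItem
  rw [insertCol_gapLeft_of_gt hc.2.1 hcb hP, insertCol_gapRight_of_le (hcb.le.trans hP.le)]
  rcases hx : R.gapLeft P with _ | x
  · rfl
  · have hbx : b ≤ x := le_of_gapLeft_eq_some hx hc.2.1 hP
    have hxa : x ≠ a := (hc.2.2.1.trans_le hbx).ne'
    have hxc : x ≠ c := (hcb.trans_le hbx).ne'
    rcases R.gapRight P with _ | y
    · rfl
    · simp [insertCol, Function.update_of_ne hxc, Function.update_of_ne hxa]

/-- **REFINEMENT MONOTONICITY.** Inserting a computed column at `c` strictly inside the gap `(a, b)`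
of two consecutive computed pressures — with any word `wc` and any two new interval words — leaves
the `by_P` item UNCHANGED at every pressure outside the open gap (`P ≤ a` or `b ≤ P`): a grid
densification re-reads only the gap it lands in. [folklore] -/
theorem lookup_insertCol_of_not_mem_gap (hc : R.Consecutive a b) (hac : a < c) (hcb : c < b)
    {P : π} (hP : P ≤ a ∨ b ≤ P) : (R.insertCol a c wc gl gr).lookup P = R.lookup P := by
  have hPc : P ≠ c := by
    rcases hP with h | h
    · exact (h.trans_lt hac).ne
    · exact (hcb.trans_le h).ne'
  by_cases hmem : P ∈ R.pts
  · have hmem' : P ∈ (R.insertCol a c wc gl gr).pts := Finset.mem_insert_of_mem hmem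
    rw [lookup_of_mem _ hmem', lookup_of_mem _ hmem]
    simp [insertCol, Function.update_of_ne hPc]
  · have hmem' : P ∉ (R.insertCol a c wc gl gr).pts := by
      simp only [insertCol, Finset.mem_insert, not_or]
      exact ⟨hPc, hmem⟩
    rw [lookup_of_not_mem _ hmem', lookup_of_not_mem _ hmem]
    have hgap : (R.insertCol a c wc gl gr).gapItem P = R.gapItem P := by
      rcases hP with h | h
      · exact insertCol_gapItem_of_lt hc hac (lt_of_le_of_ne h fun e => hmem (e ▸ hc.1))
      · exact insertCol_gapItem_of_gt hc hcb (lt_of_le_of_ne h fun e => hmem (e ▸ hc.2.1))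
    unfold offItem
    rw [insertCol_rw, hgap]

end Refine

end Rec

end PCont

end Summit.Ventures.CertifiedManyBodySolver.Downfold
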